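import Literature.MathematicalPhysics.QuantumFieldTheory.Balaban1983to89.B7Prop2Explicit
import Literature.MathematicalPhysics.QuantumFieldTheory.Balaban1983to89.BlockAveragingFederbush
import Literature.Analysis.Complex.RungeUnits
import HarnessLib

/-!
# T⁴ programme, node NE3 — kinematic refinement lemma, crew row S4d, file F1: FRACTIONAL POWERS OF A NEAR-IDENTITY
# UNIT (`upow s R = exp (s • log R)`) AND THE TWO-POINT GEODESIC `geo s b₀ b₁ = b₀ · (b₀⁻¹ b₁)^s` — the «even
# L-th-root rows» of the cell-by-cell filling

NE3 formalisation swarm `b2b-balaban-t4-ne3-formalise-*`, LEAF PROVER 07 (unit `b2b-balaban-t4-ne3-formalise-leaf-07`),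
crew row **S4d** of `HOME/t4/formal/NE3/LEAVES.md` = item (s4d) R1c∕R1d of the row-owner skeleton
`HOME/t4/b2b-balaban-t4-ne3-p1/SKELETON-NE3-P1.md` v1.1 §2 ¶3 ∕ §6: the kinematic lemma `SmoothRefine` (leaf A-H2 re-cut)
is built by a COVARIANT CELL-BY-CELL FILLING of the refined lattice — «2-cells: even `L²`-th roots of the (near-identity)
boundary holonomy in a fine axial gauge; m-cells (m = 3, 4): complete axial filling from one face with even `L`-th-root
rows».  Every such step interpolates between two unit-valued bond variables `b₀` (height `0`) and `b₁` (height `L`) along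
the geodesic `t ↦ b₀ (b₀⁻¹ b₁)^{t∕L}`, the fractional power being `exp((t∕L)·log)` with `log` the series (21) of
[Balaban1985Averaging] (tree `MatrixLog.mlog`).  THIS FILE is the (42)-free functional-analytic core of that step, shared by
rows S4c (2-cells) and S4d (m-cells): the fractional power `upow s R := exp (s • mlog R)` of an element `R` of a complete
normed `ℂ`-algebra with `‖R − 1‖` small (the two-point geodesic `geo s b₀ b₁ := b₀ · upowUnit s (b₀⁻¹ b₁)` on units is the
companion file `UnitaryGeodesic`).

CONTENT (all [folklore]; 0 sorry):
§1 `upow`: `upow_zero`, `upow_one` (`= R`, tree `MatrixLog.exp_mlog`), `upow_add` (commuting exponents, Mathlib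
`exp_add_of_commute`) — hence the ROW IDENTITY `upow ((t+1)∕L) R = upow (t∕L) R * upow (1∕L) R` (`upow_div_succ`) and
`upow (t∕L) R = (upow (1∕L) R)^t` (`upow_div_eq_pow`): consecutive ratios along a row are ALL EQUAL («even rows»),
`(upow (1∕L) R)^L = R`; SIZE `‖upow s R − 1‖ ≤ exp(2s‖R − 1‖) − 1` and the linear form `≤ 4s‖R − 1‖`
(`norm_upow_sub_one_le`, `…_le_lin`; tree `norm_mlog_le_two_mul` (26), Mathlib `Real.abs_exp_sub_one_le`); INCREMENT `‖upow (1∕L) R − 1‖ ≤ 4‖R − 1‖∕L`;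
LIPSCHITZ `‖upow s R − upow s R′‖ ≤ 6s‖R − R′‖` on `‖· − 1‖ ≤ 1∕2`, `0 ≤ s ≤ 1` (tree `FederbushMean.norm_mlog_sub_mlog_le`,
`Literature.Analysis.Complex.norm_exp_sub_exp_le`) — the estimate that turns «even rows» into flux-GRADIENT bounds;
CONJUGATION `upow s (u R u⁻¹) = u (upow s R) u⁻¹` (tree `mlog_units_conj`, Mathlib `exp_units_conj`) — gauge covariance of
the filling; §2 in a C⋆-algebra: `upow s R` is UNITARY for unitary `R` with `‖R − 1‖ ≤ 1∕4` (tree `star_mlog_eq_neg` =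
(22)–(23), Mathlib `exp_mem_unitary_of_mem_skewAdjoint`).  The unit `upowUnit` and the two-point geodesic `geo` on units
(endpoints, equal ratios, unitarity, deviations, endpoint-Lipschitz bound) are the companion file `UnitaryGeodesic`
(split for the 400-line rule).

HONEST FRAMING.  Elementary functional analysis; nothing here mentions Bałaban's average (42), minimisers, or any
conditional of the cell (`BetaPertH`, (B), (B^μ)); **NE3 is NOT proved** — this is support for the kinematic lemma
`SmoothRefine` (skeleton leaf R1), whose cell-filling rows S4b–S4e are open; nothing bears on infinite volume, a mass gap,
or the Clay problem (finite-T⁴ rung (B)+1 programme).  ABSOLUTE RULE of the cell kept: no printed sentence is a hypothesis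
of any declaration; no `sorry`; axioms ⊆ {propext, Classical.choice, Quot.sound}.  Context citations only: T. Bałaban,
Commun. Math. Phys. **98** (1985) 17–51 [Balaban1985Averaging], (21)–(23), (26) p. 21 (the logarithm and its unitarity).
PLACEMENT (human rule 2026-08-19): our lemma under `Summits/QuantumFields/BalabanUV/`; imports tree Literature modules
(`B7Prop2Explicit`, `BlockAveragingFederbush`, `RungeUnits`) only; moves nothing.  Records: `HOME/t4/formal/NE3/LEAVES.md`
row S4d; journal CLAIM NE3-S4d (CLAIMS.log l.7178).
-/

set_option autoImplicit false

open NormedSpace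

namespace Summit.QuantumFields.BalabanUV.T4Continuum.UnitaryRootInterpolation

open Literature.MathematicalPhysics.QuantumFieldTheory.Balaban1983to89
open MatrixLog B7Prop1Explicit B7Prop2Explicit

noncomputable section

/-! ## §1 Fractional powers `R^s = exp (s • log R)` in a complete normed `ℂ`-algebra -/

section Banach

variable {𝔸 : Type*} [NormedRing 𝔸] [NormedAlgebra ℂ 𝔸] [CompleteSpace 𝔸]

/-- The fractional power `R^s := exp (s • log R)` of an element near `1` (`log` = the series (21), tree `mlog`).
[folklore] -/
def upow (s : ℝ) (R : 𝔸) : 𝔸 := exp (s • mlog R)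

omit [CompleteSpace 𝔸] in
/-- `upow s R = exp (s • mlog R)` (unfolding). [folklore] -/
theorem upow_def (s : ℝ) (R : 𝔸) : upow s R = exp (s • mlog R) := rfl

omit [CompleteSpace 𝔸] in
/-- `R^0 = 1`. [folklore] -/
@[simp] theorem upow_zero (R : 𝔸) : upow 0 R = 1 := by
  simp [upow]

/-- `R^1 = R` inside the domain `‖R − 1‖ < 1` of the logarithm (tree `exp_mlog`). [folklore] -/
theorem upow_one {R : 𝔸} (hR : ‖R - 1‖ < 1) : upow 1 R = R := by
  rw [upow, one_smul, exp_mlog hR]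

omit [CompleteSpace 𝔸] in
/-- `1^s = 1`. [folklore] -/
@[simp] theorem upow_of_one (s : ℝ) : upow s (1 : 𝔸) = 1 := by
  simp [upow]

omit [CompleteSpace 𝔸] in
/-- The exponents `s • log R`, `s′ • log R` commute. [folklore] -/
theorem commute_smul_mlog (s s' : ℝ) (R : 𝔸) : Commute (s • mlog R) (s' • mlog R) :=
  ((Commute.refl (mlog R)).smul_left s).smul_right s'

/-- `R^{s+s′} = R^s · R^{s′}` (commuting exponents, Mathlib `exp_add_of_commute`). [folklore] -/
theorem upow_add (s s' : ℝ) (R : 𝔸) : upow (s + s') R = upow s R * upow s' R := by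
  letI : NormedAlgebra ℚ 𝔸 := NormedAlgebra.restrictScalars ℚ ℂ 𝔸
  rw [upow, add_smul, exp_add_of_commute (commute_smul_mlog s s' R), upow, upow]

omit [CompleteSpace 𝔸] in
/-- The powers of one element commute with each other. [folklore] -/
theorem commute_upow (s s' : ℝ) (R : 𝔸) : Commute (upow s R) (upow s' R) := by
  letI : NormedAlgebra ℚ 𝔸 := NormedAlgebra.restrictScalars ℚ ℂ 𝔸
  exact (commute_smul_mlog s s' R).exp_left.exp_right

/-- `R^n = R · … · R` for natural exponents (inside `‖R − 1‖ < 1`). [folklore] -/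
theorem upow_natCast {R : 𝔸} (hR : ‖R - 1‖ < 1) (n : ℕ) : upow (n : ℝ) R = R ^ n := by
  letI : NormedAlgebra ℚ 𝔸 := NormedAlgebra.restrictScalars ℚ ℂ 𝔸
  rw [upow, Nat.cast_smul_eq_nsmul ℝ, exp_nsmul, exp_mlog hR]

/-- `R^{n·s} = (R^s)^n`. [folklore] -/
theorem upow_natCast_mul (n : ℕ) (s : ℝ) (R : 𝔸) : upow (n * s) R = upow s R ^ n := by
  letI : NormedAlgebra ℚ 𝔸 := NormedAlgebra.restrictScalars ℚ ℂ 𝔸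
  rw [upow, mul_smul, Nat.cast_smul_eq_nsmul ℝ, exp_nsmul, upow]

/-- **THE ROW IDENTITY** («even rows»): `R^{(t+1)∕L} = R^{t∕L} · R^{1∕L}` — consecutive ratios along the row
`t ↦ R^{t∕L}` are all equal to `R^{1∕L}`. [folklore] -/
theorem upow_div_succ (L t : ℕ) (R : 𝔸) :
    upow (((t + 1 : ℕ) : ℝ) / L) R = upow ((t : ℝ) / L) R * upow (1 / (L : ℝ)) R := by
  rw [← upow_add]
  congr 1
  push_cast
  ring

/-- `R^{t∕L} = (R^{1∕L})^t`. [folklore] -/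
theorem upow_div_eq_pow (L t : ℕ) (R : 𝔸) : upow ((t : ℝ) / L) R = upow (1 / (L : ℝ)) R ^ t := by
  rw [← upow_natCast_mul]
  congr 1
  ring

/-- **THE `L`-TH ROOT**: `(R^{1∕L})^L = R` for `L ≥ 1`, `‖R − 1‖ < 1`. [folklore] -/
theorem upow_one_div_pow {L : ℕ} (hL : L ≠ 0) {R : 𝔸} (hR : ‖R - 1‖ < 1) : upow (1 / (L : ℝ)) R ^ L = R := by
  rw [← upow_div_eq_pow, div_self (Nat.cast_ne_zero.mpr hL), upow_one hR]

/-- The row ends at `R`: `R^{L∕L} = R`. [folklore] -/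
theorem upow_div_self {L : ℕ} (hL : L ≠ 0) {R : 𝔸} (hR : ‖R - 1‖ < 1) : upow ((L : ℝ) / L) R = R := by
  rw [div_self (Nat.cast_ne_zero.mpr hL), upow_one hR]

/-! ### Size -/

/-- The exponent has norm `|s|·‖log R‖ ≤ |s|·2‖R − 1‖` on `‖R − 1‖ ≤ 1∕2` ((26): `|log W| ≤ 2|W − 1|`). [folklore] -/
theorem norm_smul_mlog_le {R : 𝔸} {β : ℝ} (hR : ‖R - 1‖ ≤ β) (hβ : β ≤ 1 / 2) (s : ℝ) :
    ‖s • mlog R‖ ≤ |s| * (2 * β) := by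
  rw [norm_smul, Real.norm_eq_abs]
  refine mul_le_mul_of_nonneg_left ?_ (abs_nonneg s)
  exact (norm_mlog_le_two_mul (hR.trans hβ)).trans (by linarith)

/-- **SIZE**: `‖R^s − 1‖ ≤ exp(2|s|β) − 1` for `‖R − 1‖ ≤ β ≤ 1∕2`. [folklore] -/
theorem norm_upow_sub_one_le {R : 𝔸} {β : ℝ} (hR : ‖R - 1‖ ≤ β) (hβ : β ≤ 1 / 2) (s : ℝ) :
    ‖upow s R - 1‖ ≤ Real.exp (|s| * (2 * β)) - 1 :=
  B7Transfer.norm_exp_sub_one_le_of_le _ (norm_smul_mlog_le hR hβ s)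

/-- **SIZE, linear form**: `‖R^s − 1‖ ≤ 4|s|β` for `‖R − 1‖ ≤ β ≤ 1∕2` and `2|s|β ≤ 1`. [folklore] -/
theorem norm_upow_sub_one_le_lin {R : 𝔸} {β : ℝ} (hR : ‖R - 1‖ ≤ β) (hβ : β ≤ 1 / 2) {s : ℝ}
    (hs : |s| * (2 * β) ≤ 1) : ‖upow s R - 1‖ ≤ 4 * |s| * β := by
  have h0 : 0 ≤ |s| * (2 * β) := mul_nonneg (abs_nonneg s) (by linarith [(norm_nonneg _).trans hR])
  -- `exp x − 1 ≤ 2x` on `0 ≤ x ≤ 1` (Mathlib `Real.abs_exp_sub_one_le`; tree `SquarefreeSums.exp_sub_one_le_two_mul`)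
  have hexp : Real.exp (|s| * (2 * β)) - 1 ≤ 2 * (|s| * (2 * β)) := by
    have h := Real.abs_exp_sub_one_le (x := |s| * (2 * β)) (by rwa [abs_of_nonneg h0])
    rw [abs_of_nonneg h0] at h
    exact (le_abs_self _).trans h
  calc ‖upow s R - 1‖ ≤ Real.exp (|s| * (2 * β)) - 1 := norm_upow_sub_one_le hR hβ s
    _ ≤ 2 * (|s| * (2 * β)) := hexp
    _ = 4 * |s| * β := by ring

/-- **INCREMENT of a row of length `L`**: `‖R^{1∕L} − 1‖ ≤ 4β∕L` for `‖R − 1‖ ≤ β ≤ 1∕2`, `L ≥ 1`. [folklore] -/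
theorem norm_upow_one_div_sub_one_le {R : 𝔸} {β : ℝ} (hR : ‖R - 1‖ ≤ β) (hβ : β ≤ 1 / 2) {L : ℕ} (hL : 1 ≤ L) :
    ‖upow (1 / (L : ℝ)) R - 1‖ ≤ 4 * β / L := by
  have hL' : (1 : ℝ) ≤ L := by exact_mod_cast hL
  have hβ0 : 0 ≤ β := (norm_nonneg _).trans hR
  have habs : |1 / (L : ℝ)| = 1 / L := abs_of_nonneg (by positivity)
  have hs : |1 / (L : ℝ)| * (2 * β) ≤ 1 := by
    rw [habs]
    calc 1 / (L : ℝ) * (2 * β) ≤ 1 * (2 * β) := by gcongr; exact (div_le_one (by positivity)).mpr hL'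
      _ ≤ 1 := by linarith
  calc ‖upow (1 / (L : ℝ)) R - 1‖ ≤ 4 * |1 / (L : ℝ)| * β := norm_upow_sub_one_le_lin hR hβ hs
    _ = 4 * β / L := by rw [habs]; ring

/-- **SIZE along a row**: `‖R^{t∕L} − 1‖ ≤ 4(t∕L)β ≤ 4β` for `t ≤ L`, `‖R − 1‖ ≤ β ≤ 1∕2`. [folklore] -/
theorem norm_upow_div_sub_one_le {R : 𝔸} {β : ℝ} (hR : ‖R - 1‖ ≤ β) (hβ : β ≤ 1 / 2) {L t : ℕ} (hL : 1 ≤ L)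
    (ht : t ≤ L) : ‖upow ((t : ℝ) / L) R - 1‖ ≤ 4 * ((t : ℝ) / L) * β := by
  have hL' : (0 : ℝ) < L := by exact_mod_cast hL
  have hβ0 : 0 ≤ β := (norm_nonneg _).trans hR
  have htL : (t : ℝ) / L ≤ 1 := (div_le_one hL').mpr (by exact_mod_cast ht)
  have habs : |(t : ℝ) / L| = t / L := abs_of_nonneg (by positivity)
  have hs : |(t : ℝ) / L| * (2 * β) ≤ 1 := by
    rw [habs]
    calc (t : ℝ) / L * (2 * β) ≤ 1 * (2 * β) := by gcongr
      _ ≤ 1 := by linarith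
  simpa [habs] using norm_upow_sub_one_le_lin hR hβ hs

/-! ### Lipschitz dependence on `R` -/

/-- **LIPSCHITZ**: `‖R^s − R′^s‖ ≤ 2|s|·exp(2|s|ρ)·‖R − R′‖` on `‖R − 1‖, ‖R′ − 1‖ ≤ ρ ≤ 1∕2` (the logarithm is
`(1 + ρ∕(1−ρ)) ≤ 2`-Lipschitz there, the exponential `exp(max)`-Lipschitz). [folklore] -/
theorem norm_upow_sub_upow_le [NormOneClass 𝔸] {R R' : 𝔸} {ρ : ℝ} (hρ : ρ ≤ 1 / 2) (hR : ‖R - 1‖ ≤ ρ)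
    (hR' : ‖R' - 1‖ ≤ ρ) (s : ℝ) :
    ‖upow s R - upow s R'‖ ≤ 2 * |s| * Real.exp (|s| * (2 * ρ)) * ‖R - R'‖ := by
  have hρ1 : ρ < 1 := by linarith
  have hρ0 : 0 ≤ ρ := (norm_nonneg _).trans hR
  have hlog := FederbushMean.norm_mlog_sub_mlog_le hρ1 hR hR'
  have hfac : 1 + ρ / (1 - ρ) ≤ 2 := by
    have : ρ / (1 - ρ) ≤ 1 := (div_le_one (by linarith)).mpr (by linarith)
    linarith
  have h1 : ‖s • mlog R - s • mlog R'‖ ≤ |s| * (2 * ‖R - R'‖) := by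
    rw [← smul_sub, norm_smul, Real.norm_eq_abs]
    refine mul_le_mul_of_nonneg_left ?_ (abs_nonneg s)
    calc ‖mlog R - mlog R'‖ ≤ (1 + ρ / (1 - ρ)) * ‖R - R'‖ := hlog
      _ ≤ 2 * ‖R - R'‖ := mul_le_mul_of_nonneg_right hfac (norm_nonneg _)
  have hmax : max ‖s • mlog R‖ ‖s • mlog R'‖ ≤ |s| * (2 * ρ) :=
    max_le (norm_smul_mlog_le hR hρ s) (norm_smul_mlog_le hR' hρ s)
  calc ‖upow s R - upow s R'‖ ≤ ‖s • mlog R - s • mlog R'‖ * Real.exp (max ‖s • mlog R‖ ‖s • mlog R'‖) :=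
        Literature.Analysis.Complex.norm_exp_sub_exp_le _ _
    _ ≤ (|s| * (2 * ‖R - R'‖)) * Real.exp (|s| * (2 * ρ)) := by
        gcongr
    _ = 2 * |s| * Real.exp (|s| * (2 * ρ)) * ‖R - R'‖ := by ring

/-- **LIPSCHITZ, numerical form**: `‖R^s − R′^s‖ ≤ 6|s|·‖R − R′‖` for `‖R − 1‖, ‖R′ − 1‖ ≤ 1∕2`, `|s| ≤ 1`
(`2e ≤ 6`). [folklore] -/
theorem norm_upow_sub_upow_le_six [NormOneClass 𝔸] {R R' : 𝔸} (hR : ‖R - 1‖ ≤ 1 / 2) (hR' : ‖R' - 1‖ ≤ 1 / 2)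
    {s : ℝ} (hs : |s| ≤ 1) : ‖upow s R - upow s R'‖ ≤ 6 * |s| * ‖R - R'‖ := by
  have h := norm_upow_sub_upow_le (le_refl (1 / 2 : ℝ)) hR hR' s
  have he : Real.exp (|s| * (2 * (1 / 2))) ≤ 3 := by
    have h1 : |s| * (2 * (1 / 2 : ℝ)) ≤ 1 := by linarith
    have h2 := Real.exp_le_exp.mpr h1
    have h3 : Real.exp 1 < 3 := lt_trans Real.exp_one_lt_d9 (by norm_num)
    linarith
  calc ‖upow s R - upow s R'‖ ≤ 2 * |s| * Real.exp (|s| * (2 * (1 / 2))) * ‖R - R'‖ := h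
    _ ≤ 2 * |s| * 3 * ‖R - R'‖ := by gcongr
    _ = 6 * |s| * ‖R - R'‖ := by ring

/-! ### Conjugation (gauge covariance of the filling) -/

/-- **CONJUGATION**: `(u R u⁻¹)^s = u R^s u⁻¹` for `u ∈ {‖u‖ ≤ 1, ‖u⁻¹‖ ≤ 1}` and `‖R − 1‖ < 1` ((11)∕(23):
`log (u X u⁻¹) = u (log X) u⁻¹`, tree `mlog_units_conj`; Mathlib `exp_units_conj`). [folklore] -/
theorem upow_units_conj [NormOneClass 𝔸] {u : 𝔸ˣ} (hu : u ∈ U1 𝔸) {R : 𝔸} (hR : ‖R - 1‖ < 1) (s : ℝ) :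
    upow s ((u : 𝔸) * R * ((u⁻¹ : 𝔸ˣ) : 𝔸)) = (u : 𝔸) * upow s R * ((u⁻¹ : 𝔸ˣ) : 𝔸) := by
  letI : NormedAlgebra ℚ 𝔸 := NormedAlgebra.restrictScalars ℚ ℂ 𝔸
  rw [upow, mlog_units_conj hu hR, ← smul_mul_assoc, ← mul_smul_comm, exp_units_conj, upow]

end Banach

/-! ## §2 Unitarity in a C⋆-algebra ((22)–(23): the logarithm of a near-identity unitary is skew-adjoint) -/

section CStar

variable {𝔸 : Type*} [CStarAlgebra 𝔸]

/-- The exponent `s • log R` is skew-adjoint for unitary `R` with `‖R − 1‖ ≤ 1∕4` (tree `star_mlog_eq_neg`). [folklore] -/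
theorem smul_mlog_mem_skewAdjoint {R : 𝔸} (hR : R ∈ unitary 𝔸) (h : ‖R - 1‖ ≤ 1 / 4) (s : ℝ) :
    s • mlog R ∈ skewAdjoint 𝔸 := by
  refine skewAdjoint.smul_mem _ ?_
  rw [skewAdjoint.mem_iff]
  exact star_mlog_eq_neg hR h

/-- **`R^s` IS UNITARY** for unitary `R` with `‖R − 1‖ ≤ 1∕4` (Mathlib `exp_mem_unitary_of_mem_skewAdjoint`). [folklore] -/
theorem upow_mem_unitary {R : 𝔸} (hR : R ∈ unitary 𝔸) (h : ‖R - 1‖ ≤ 1 / 4) (s : ℝ) : upow s R ∈ unitary 𝔸 := by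
  letI : NormedAlgebra ℚ 𝔸 := NormedAlgebra.restrictScalars ℚ ℂ 𝔸
  exact NormedSpace.exp_mem_unitary_of_mem_skewAdjoint (smul_mlog_mem_skewAdjoint hR h s)

end CStar

end

end Summit.QuantumFields.BalabanUV.T4Continuum.UnitaryRootInterpolation
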